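import Summits.QuantumFields.YangMills.Theorems.UnitScaleTiltProp7NonlinPartPackaged
import Summits.QuantumFields.YangMills.Theorems.UnitScaleTiltProp7ResumCoeffRows
import HarnessLib

/-!
# Prop 7, route-R E′, (E1-c) brick F4c(v) — THE PURE-GAUGE PIECE `P₂`, BOND (SUP) ROW: `‖P₂ψ(b) − P₂ψ′(b)‖ ≤ 2m·δ_d + 2e^{2R₀}·m_d·δ′ + Bnd_𝒩`

Route `UnitScaleTilt`, crux K1 child «MinimiserStabilityRegPr» (`stmt-QuantumFields-19200`), cell ym3-torus, width seat px15 (gen 2); pen «px15 g2: (E1-c) GO-LOCATE» (★p1 g15,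
2026-08-28T20:45:05Z), LOCATE `LOCATE-E1C-DIVLIPSCHITZ-px15g2.md` §6.  THEOREMS ONLY (0 `def`, 0 `sorry`); `--supports stmt-QuantumFields-19200`, count-neutral.
YM₃ on T³ is a ladder rung (R3), not the Clay problem; nothing here claims the stub, the crux, d = 4 or the mass gap.

WHAT.  The `q`-gauge of ✓p667460's contraction has two members, `ℓ²·sup‖D*_W A‖` (for `P₂`: F4c(iv-c) ⧗p673331 `norm_divB_gaugePiece_sub_le`) and `ℓ·sup_b‖A b‖`.  This file is the
second member for `P₂(X;H) = log(1 + e^{−X}(e^{X+H} − e^X)) − H`, `X = c•ψ(y)`, `H = c•D_μψ(y)`: splitting `P₂ = ĉ(ψ y)H + 𝒩` (F4b ✓p671886 coefficient, F3c ✓p671341),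
  ★★ `norm_gaugePiece_bond_sub_le`: `‖P₂ψ(μ,y) − P₂ψ′(μ,y)‖ ≤ 2m·δ_d + 2e^{2R₀}·m_d·δ′ + [(A+2A²)Kδ_d + (4A∕3+6A²)K²m_d]`
(cone size `2‖λ‖‖Z‖` for `‖ψ‖ ≤ m ≤ ½`; local Lipschitz `2e^{2R₀}`; F4c(iv-b) ✓p673053 `norm_nonlinPart_sub_le`; `K = δ+δ′`, `A = e^{R₀}e^{R₀+K}`, `A·K ≤ ½`).  Multiplying by `ℓ`:
every summand is (X-row) × (X-row of `ψ − ψ′`).  HONEST SCOPE.  Assembly ([folklore]).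

References: T. Bałaban, CMP 98 (1985) 17–51 [Balaban1985Averaging] ((26), (32)–(34) p.22); CMP 99 (1985) 389–434 [Balaban1985BackgroundPropagators] ((3.8) p.392).
-/

set_option autoImplicit false

noncomputable section

open scoped BigOperators Matrix.Norms.L2Operator Matrix
open NormedSpace

namespace Summit.QuantumFields.YangMills.Theorems.Prop7GaugePieceSupRow

open Literature.MathematicalPhysics.QuantumFieldTheory.Balaban1983to89
open B9Eq39Adjoint (R covD)
open Literature.Analysis.Calculus.ExpDifferential (gSer ad)
open Literature.Analysis.Complex (logOnePlus)
open Summit.QuantumFields.YangMills.Theorems.Prop7NonlinPartPackaged (norm_nonlinPart_sub_le)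
open Summit.QuantumFields.YangMills.Theorems.Prop7ResumCoeffRows (norm_coeff_le_two_mul norm_coeff_sub_coeff_le)

variable {n : Type*} [Fintype n] [DecidableEq n] [Nonempty n]
variable {S : Type*} {ι : Type*} (T : ι → Equiv.Perm S) (U : ι → S → (Matrix n n ℂ)ˣ)

/-- ★★ **BOND ROW OF `P₂`**: `‖P₂ψ(μ,y) − P₂ψ′(μ,y)‖ ≤ 2m·δ_d + 2e^{2R₀}·m_d·δ′ + [(A+2A²)Kδ_d + (4A∕3+6A²)K²m_d]`. [cite: Balaban1985Averaging, (32)-(34) p.22] -/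
theorem norm_gaugePiece_bond_sub_le {c : ℂ} (hc : ‖c‖ ≤ 1) (ψ ψ' : S → Matrix n n ℂ) {R₀ m md δ δ' δd : ℝ}
    (hm : ∀ y, ‖ψ y‖ ≤ m) (hmR : m ≤ R₀) (hmhalf : m ≤ 1 / 2) (hm' : ∀ y, ‖ψ' y‖ ≤ R₀) (hmd : ∀ y, ‖ψ y - ψ' y‖ ≤ md)
    (hδ0 : 0 ≤ δ) (hδ : ∀ μ y, ‖covD T U μ ψ y‖ ≤ δ) (hδ'0 : 0 ≤ δ') (hδ' : ∀ μ y, ‖covD T U μ ψ' y‖ ≤ δ')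
    (hδd : ∀ μ y, ‖covD T U μ ψ y - covD T U μ ψ' y‖ ≤ δd)
    (hs : Real.exp R₀ * Real.exp (R₀ + (δ + δ')) * (δ + δ') ≤ 1 / 2) (μ : ι) (y : S) :
    ‖(logOnePlus (exp (-(c • ψ y)) * (exp (c • ψ y + c • covD T U μ ψ y) - exp (c • ψ y))) - c • covD T U μ ψ y)
        - (logOnePlus (exp (-(c • ψ' y)) * (exp (c • ψ' y + c • covD T U μ ψ' y) - exp (c • ψ' y))) - c • covD T U μ ψ' y)‖
      ≤ 2 * m * δd + 2 * Real.exp (2 * R₀) * md * δ'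
        + (((Real.exp R₀ * Real.exp (R₀ + (δ + δ'))) + 2 * (Real.exp R₀ * Real.exp (R₀ + (δ + δ'))) ^ 2) * (δ + δ') * δd
          + (4 / 3 * (Real.exp R₀ * Real.exp (R₀ + (δ + δ'))) + 6 * (Real.exp R₀ * Real.exp (R₀ + (δ + δ'))) ^ 2) * (δ + δ') ^ 2 * md) := by
  set H := c • covD T U μ ψ y with hH
  set H' := c • covD T U μ ψ' y with hH'
  have hcn : ∀ M : Matrix n n ℂ, ‖c • M‖ ≤ ‖M‖ := fun M => by
    rw [norm_smul]; nlinarith [norm_nonneg c, norm_nonneg M]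
  -- split P₂ = ĉ(ψ y)H + 𝒩, and ĉ(ψ)H − ĉ(ψ′)H′ = ĉ(ψ)(H − H′) + (ĉ(ψ)H′ − ĉ(ψ′)H′)
  have e : (logOnePlus (exp (-(c • ψ y)) * (exp (c • ψ y + H) - exp (c • ψ y))) - H)
        - (logOnePlus (exp (-(c • ψ' y)) * (exp (c • ψ' y + H') - exp (c • ψ' y))) - H')
      = (gSer ℂ (ad ℂ (c • ψ y)) (H - H') - (H - H'))
        + ((gSer ℂ (ad ℂ (c • ψ y)) H' - H') - (gSer ℂ (ad ℂ (c • ψ' y)) H' - H'))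
        + (((logOnePlus (exp (-(c • ψ y)) * (exp (c • ψ y + H) - exp (c • ψ y))) - H - (gSer ℂ (ad ℂ (c • ψ y)) H - H))
          - ((logOnePlus (exp (-(c • ψ' y)) * (exp (c • ψ' y + H') - exp (c • ψ' y))) - H' - (gSer ℂ (ad ℂ (c • ψ' y)) H' - H'))))) := by
    rw [map_sub]
    abel
  rw [e]
  have h1 : ‖gSer ℂ (ad ℂ (c • ψ y)) (H - H') - (H - H')‖ ≤ 2 * m * δd := by
    have h := norm_coeff_le_two_mul hc ((hm y).trans hmhalf) (H - H')
    have hHd : ‖H - H'‖ ≤ δd := by rw [hH, hH', ← smul_sub]; exact (hcn _).trans (hδd μ y)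
    have hm0 : 0 ≤ m := (norm_nonneg _).trans (hm y)
    calc _ ≤ 2 * ‖ψ y‖ * ‖H - H'‖ := h
      _ ≤ 2 * m * δd := by nlinarith [hm y, hHd, norm_nonneg (ψ y), norm_nonneg (H - H')]
  have h2 : ‖(gSer ℂ (ad ℂ (c • ψ y)) H' - H') - (gSer ℂ (ad ℂ (c • ψ' y)) H' - H')‖ ≤ 2 * Real.exp (2 * R₀) * md * δ' := by
    have h := norm_coeff_sub_coeff_le hc ((hm y).trans hmR) (hm' y) H'
    have hH'b : ‖H'‖ ≤ δ' := (hcn _).trans (hδ' μ y)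
    have h0 : 0 ≤ 2 * Real.exp (2 * R₀) := by positivity
    calc _ ≤ 2 * Real.exp (2 * R₀) * ‖ψ y - ψ' y‖ * ‖H'‖ := h
      _ ≤ 2 * Real.exp (2 * R₀) * md * δ' := by
          have hmd0 : 0 ≤ md := (norm_nonneg _).trans (hmd y)
          have := mul_le_mul (mul_le_mul_of_nonneg_left (hmd y) h0) hH'b (norm_nonneg _) (mul_nonneg h0 hmd0)
          linarith
  have h3 := norm_nonlinPart_sub_le T U hc ψ ψ' (fun z => (hm z).trans hmR) hm' hmd hδ0 hδ hδ'0 hδ' hδd hs μ y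
  refine (norm_add_le _ _).trans (add_le_add ((norm_add_le _ _).trans (add_le_add h1 h2)) ?_)
  exact h3

end Summit.QuantumFields.YangMills.Theorems.Prop7GaugePieceSupRow

end
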